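import Summits.Ventures.DiscreteObjects.Hadamard.PrimeSquareOrder

/-!
# Hadamard 668 census, family F12 — tools for signed automorphisms of EVEN order (involutions) of a Hadamard matrix (kernel, general)

Framing: lottery ticket; floor = certified bounds/negative ranges.

Cell pub-namedobj (venture DiscreteObjects), target (H), hadamard gen 12.  The composite-order table of gens 11 treats ODD orders;
this file supplies the general lemmas for the even side (a signed-permutation automorphism `(π, κ, d, e)` of a Hadamard matrix `H`,
`H (π i) (κ j) = d i * e j * H i j`, `IsSignedAut`):
* `card_eq_four_mul_of_three_orth`: three pairwise-orthogonal `±1` vectors on a finite set `S` force `|S| = 4 · #{u = v = w}`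
  (so `4 ∣ |S|`; the classical 'three rows of a Hadamard matrix' count, stated for arbitrary index sets);
* (with the tree's `isHadamard_transpose`, `isSignedAut_transpose` every row statement has a column version for free);
* `signedAut_trace` (**trace lemma**): `Σ_{π i = i} d i = Σ_{κ j = j} e j` — the signed permutation matrices are similar via `H`;
  proved by double counting `Σ_{i,j} d i · H i (κ j) · H (π i) (κ j)` with row and column orthogonality;
* `signedAut_fixed_sign`: a fixed row and a fixed column carry the same sign (`π i = i`, `κ j = j` ⇒ `d i = e j`);
* `signedAut_sq_sign`: if `π² = κ² = 1` pointwise then `d i · d (π i) · e j · e (κ j) = 1` (the 'type' `ε = d i · d (π i)` is one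
  constant, equal on rows and columns);
* `signedAut_rowPair`, `signedAut_colPair`: for a moved row `i`, `Σ_j e j · H i j · H i (κ j) = 0` (rows `i`, `π i` are orthogonal),
  and the column analogue;
* `sum_moved_eq_card_sub_four_mul`, `two_dvd_card_moved`: for a pointwise involution `τ`, a `τ`-invariant `±1` function on the
  moved points has sum `≡ #moved (mod 4)`, and `#moved` is even (free `τ`-orbits, `dvd_card_of_free`);
* `signedAut_snd_involutive_of_fst_eq_one`, **`signedAut_snd_eq_one_of_fst_eq_one`**: if the ROW permutation is trivial then
  `κ² = 1`, and if moreover `|ι| ≡ 4 (mod 8)`, `|ι| ≠ 4`, then `κ = 1` (the `+`-signed rows would compress to `|ι|/2 ≥ 3`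
  pairwise-orthogonal `±1` vectors of length `|ι|/2 ≡ 2 (mod 4)`); `H(4)` is a genuine exception.  Row version
  `signedAut_fst_eq_one_of_snd_eq_one` by transposition.  (For ODD exponents the tree already has `signedAut_snd_eq_one`.)
Ours (elementary), not literature — nearest print: the type analysis of involutions of Hadamard matrices in Kimura's and
Tonchev's papers on orders 24–36; no `sorry`.
-/

namespace Summit.Ventures.DiscreteObjects.Hadamard

open Finset BigOperators Matrix

open Literature.Combinatorics.Designs.GoethalsSeidel (IsHadamardMatrix)

variable {ι : Type*} [Fintype ι] [DecidableEq ι]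

section threeVectors

omit [Fintype ι] [DecidableEq ι] in
/-- pointwise value of `(u + v)(u + w)` for signs: `4` if `u = v = w`, else `0` -/
private lemma three_sign_term {a b c : ℤ} (ha : a = 1 ∨ a = -1) (hb : b = 1 ∨ b = -1) (hc : c = 1 ∨ c = -1) :
    (a + b) * (a + c) = if a = b ∧ a = c then 4 else 0 := by
  rcases ha with rfl | rfl <;> rcases hb with rfl | rfl <;> rcases hc with rfl | rfl <;> norm_num

omit [Fintype ι] [DecidableEq ι] in
/-- **Three pairwise-orthogonal `±1` vectors.**  If `u, v, w` take values `±1` on the finite set `S` and are pairwise orthogonal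
there, then `|S| = 4 · #{j ∈ S | u j = v j = w j}`; in particular `4 ∣ |S|`. -/
theorem card_eq_four_mul_of_three_orth (S : Finset ι) (u v w : ι → ℤ)
    (hu : ∀ j ∈ S, u j = 1 ∨ u j = -1) (hv : ∀ j ∈ S, v j = 1 ∨ v j = -1) (hw : ∀ j ∈ S, w j = 1 ∨ w j = -1)
    (huv : ∑ j ∈ S, u j * v j = 0) (huw : ∑ j ∈ S, u j * w j = 0) (hvw : ∑ j ∈ S, v j * w j = 0) :
    (S.card : ℤ) = 4 * ((S.filter fun j => u j = v j ∧ u j = w j).card : ℤ) := by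
  have huu : ∑ j ∈ S, u j * u j = S.card := by
    rw [Finset.sum_congr rfl fun j hj => pm_mul_self (hu j hj)]
    simp
  have key : ∑ j ∈ S, (u j + v j) * (u j + w j) = (S.card : ℤ) := by
    have e : ∀ j ∈ S, (u j + v j) * (u j + w j) = u j * u j + u j * w j + u j * v j + v j * w j := by
      intro j _; ring
    rw [Finset.sum_congr rfl e, Finset.sum_add_distrib, Finset.sum_add_distrib, Finset.sum_add_distrib, huu, huw, huv, hvw]
    ring
  have key' : ∑ j ∈ S, (u j + v j) * (u j + w j) = ∑ j ∈ S, (if u j = v j ∧ u j = w j then (4 : ℤ) else 0) :=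
    Finset.sum_congr rfl fun j hj => three_sign_term (hu j hj) (hv j hj) (hw j hj)
  rw [← key, key', ← Finset.sum_filter]
  simp [mul_comm]

end threeVectors

section transpose
variable {H : Matrix ι ι ℤ}

/-- a column of a Hadamard matrix has squared norm equal to the order -/
lemma hadamard_col_self (hH : IsHadamardMatrix H) (hcard : (Fintype.card ι : ℤ) ≠ 0) (j : ι) :
    ∑ i, H i j * H i j = (Fintype.card ι : ℤ) := by
  have hT := transpose_mul_self_of_mul_transpose H _ hcard hH.2
  have e3 := congrFun (congrFun hT j) j
  rw [Matrix.mul_apply] at e3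
  simpa [Matrix.transpose_apply, Matrix.smul_apply, Matrix.one_apply_eq] using e3

end transpose

section signs
variable {H : Matrix ι ι ℤ} {π κ : Equiv.Perm ι} {d e : ι → ℤ}

omit [Fintype ι] [DecidableEq ι] in
/-- two signs with product `1` are equal -/
lemma pm_eq_of_mul_eq_one {a b : ℤ} (ha : a = 1 ∨ a = -1) (hb : b = 1 ∨ b = -1) (h : a * b = 1) : a = b := by
  rcases ha with rfl | rfl <;> rcases hb with rfl | rfl <;> first | rfl | norm_num at h

omit [Fintype ι] [DecidableEq ι] in
/-- **A fixed row and a fixed column carry the same sign.** -/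
theorem signedAut_fixed_sign (hH1 : ∀ i j, H i j = 1 ∨ H i j = -1) (haut : IsSignedAut H π κ d e)
    {i j : ι} (hi : π i = i) (hj : κ j = j) : d i = e j := by
  obtain ⟨hd, he, hA⟩ := haut
  have h := hA i j
  rw [hi, hj] at h
  have hne : H i j ≠ 0 := pm_ne_zero (hH1 i j)
  have : (d i * e j - 1) * H i j = 0 := by linarith
  rcases mul_eq_zero.mp this with h0 | h0
  · exact pm_eq_of_mul_eq_one (hd i) (he j) (by linarith)
  · exact (hne h0).elim

omit [Fintype ι] [DecidableEq ι] in
/-- **The type of an involution pair.**  If `π (π i) = i` and `κ (κ j) = j` pointwise then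
`d i · d (π i) · (e j · e (κ j)) = 1` for all `i, j`: the sign `ε = d i · d (π i)` is one constant on rows and columns. -/
theorem signedAut_sq_sign (hH1 : ∀ i j, H i j = 1 ∨ H i j = -1) (haut : IsSignedAut H π κ d e)
    (hπ : ∀ i, π (π i) = i) (hκ : ∀ j, κ (κ j) = j) (i j : ι) : d i * d (π i) * (e j * e (κ j)) = 1 := by
  obtain ⟨-, -, hA⟩ := haut
  have h1 := hA (π i) (κ j)
  rw [hπ i, hκ j, hA i j] at h1
  have hne : H i j ≠ 0 := pm_ne_zero (hH1 i j)
  have : (d i * d (π i) * (e j * e (κ j)) - 1) * H i j = 0 := by linarith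
  rcases mul_eq_zero.mp this with h0 | h0
  · linarith
  · exact (hne h0).elim

/-- **Row-pair identity.**  For a row `i` moved by `π`: `Σ_j e j · H i j · H i (κ j) = 0` (rows `i` and `π i` are orthogonal, and
row `π i` is row `i` re-signed by `d i · e` and permuted by `κ`). -/
theorem signedAut_rowPair (hH : IsHadamardMatrix H) (haut : IsSignedAut H π κ d e) {i : ι} (hi : π i ≠ i) :
    ∑ j, e j * (H i j * H i (κ j)) = 0 := by
  obtain ⟨hd, he, hA⟩ := haut
  have orth : ∑ j, H i (κ j) * H (π i) (κ j) = 0 := by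
    rw [Fintype.sum_equiv κ (fun j => H i (κ j) * H (π i) (κ j)) (fun j => H i j * H (π i) j) (fun j => rfl)]
    exact hadamard_row_orth H hH (Ne.symm hi)
  have e1 : ∑ j, H i (κ j) * H (π i) (κ j) = d i * ∑ j, e j * (H i j * H i (κ j)) := by
    rw [Finset.mul_sum]
    refine Finset.sum_congr rfl fun j _ => ?_
    rw [hA i j]; ring
  rw [e1] at orth
  rcases mul_eq_zero.mp orth with h0 | h0
  · exact absurd h0 (pm_ne_zero (hd i))
  · exact h0

/-- **Column-pair identity.**  For a column `j` moved by `κ`: `Σ_i d i · H i j · H (π i) j = 0`. -/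
theorem signedAut_colPair (hH : IsHadamardMatrix H) (hcard : (Fintype.card ι : ℤ) ≠ 0) (haut : IsSignedAut H π κ d e)
    {j : ι} (hj : κ j ≠ j) : ∑ i, d i * (H i j * H (π i) j) = 0 := by
  have h := signedAut_rowPair (isHadamard_transpose hH hcard) (isSignedAut_transpose haut) hj
  simpa only [Matrix.transpose_apply] using h

/-- **Trace lemma.**  For a signed automorphism of a Hadamard matrix, the signed count of fixed rows equals the signed count of
fixed columns: `Σ_{π i = i} d i = Σ_{κ j = j} e j` (the signed permutation matrices `P`, `Q` with `P H = H Q` are similar). -/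
theorem signedAut_trace (hH : IsHadamardMatrix H) (hcard : (Fintype.card ι : ℤ) ≠ 0) (haut : IsSignedAut H π κ d e) :
    ∑ i ∈ univ.filter (fun i => π i = i), d i = ∑ j ∈ univ.filter (fun j => κ j = j), e j := by
  obtain ⟨hd, he, hA⟩ := haut
  set n : ℤ := (Fintype.card ι : ℤ) with hn
  -- the double sum, evaluated by rows
  have hrow : ∀ i, ∑ j, H i (κ j) * H (π i) (κ j) = if π i = i then n else 0 := by
    intro i
    rw [Fintype.sum_equiv κ (fun j => H i (κ j) * H (π i) (κ j)) (fun j => H i j * H (π i) j) (fun j => rfl)]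
    split_ifs with h
    · rw [h]; exact hadamard_row_self H hH i
    · exact hadamard_row_orth H hH (Ne.symm h)
  have T1 : ∑ i, ∑ j, d i * (H i (κ j) * H (π i) (κ j)) = n * ∑ i ∈ univ.filter (fun i => π i = i), d i := by
    have e1 : ∀ i, ∑ j, d i * (H i (κ j) * H (π i) (κ j)) = d i * (if π i = i then n else 0) := by
      intro i; rw [← Finset.mul_sum, hrow i]
    rw [Finset.sum_congr rfl fun i _ => e1 i, Finset.sum_filter, Finset.mul_sum]
    apply Finset.sum_congr rfl
    intro i _
    split_ifs <;> ring
  -- evaluated by columns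
  have hcol : ∀ j, ∑ i, H i j * H i (κ j) = if κ j = j then n else 0 := by
    intro j
    split_ifs with h
    · rw [h]; exact hadamard_col_self hH hcard j
    · exact hadamard_col_orth H hH hcard (Ne.symm h)
  have T2 : ∑ i, ∑ j, d i * (H i (κ j) * H (π i) (κ j)) = n * ∑ j ∈ univ.filter (fun j => κ j = j), e j := by
    have e1 : ∀ i j, d i * (H i (κ j) * H (π i) (κ j)) = e j * (H i j * H i (κ j)) := by
      intro i j
      rw [hA i j]
      have := pm_mul_self (hd i)
      calc d i * (H i (κ j) * (d i * e j * H i j)) = (d i * d i) * (e j * (H i j * H i (κ j))) := by ring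
        _ = e j * (H i j * H i (κ j)) := by rw [this, one_mul]
    have e2 : ∀ j, ∑ i, e j * (H i j * H i (κ j)) = e j * (if κ j = j then n else 0) := by
      intro j; rw [← Finset.mul_sum, hcol j]
    rw [Finset.sum_congr rfl fun i _ => Finset.sum_congr rfl fun j _ => e1 i j, Finset.sum_comm,
      Finset.sum_congr rfl fun j _ => e2 j, Finset.sum_filter, Finset.mul_sum]
    apply Finset.sum_congr rfl
    intro j _
    split_ifs <;> ring
  have h := T1.symm.trans T2
  exact mul_left_cancel₀ hcard h

end signs

section movedSums

/-- **Even number of moved points** of a pointwise involution. -/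
theorem two_dvd_card_moved (τ : Equiv.Perm ι) (hτ : ∀ x, τ (τ x) = x) : 2 ∣ (univ.filter fun x => τ x ≠ x).card := by
  have hτ2 : τ ^ 2 = 1 := by ext x; simp [pow_two, hτ x]
  apply dvd_card_of_free τ (by norm_num) hτ2 _ _ le_rfl
  · intro y hy
    simp only [Finset.mem_filter, Finset.mem_univ, true_and] at hy ⊢
    rw [hτ y]; exact Ne.symm hy
  · intro y hy k hk0 hk2
    simp only [Finset.mem_filter, Finset.mem_univ, true_and] at hy
    have : k = 1 := by omega
    subst this
    simpa using hy

/-- **Invariant signs on the moved points, mod 4.**  For a pointwise involution `τ` and a `±1` function `g` on the `τ`-moved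
points with `g (τ x) = g x`: `Σ_{moved} g = #moved − 4m` for some `m` (the points with `g = −1` form free `τ`-orbits). -/
theorem sum_moved_eq_card_sub_four_mul (τ : Equiv.Perm ι) (hτ : ∀ x, τ (τ x) = x) (g : ι → ℤ)
    (hg : ∀ x, τ x ≠ x → (g x = 1 ∨ g x = -1)) (hinv : ∀ x, τ x ≠ x → g (τ x) = g x) :
    ∃ m : ℕ, ∑ x ∈ univ.filter (fun x => τ x ≠ x), g x = ((univ.filter fun x => τ x ≠ x).card : ℤ) - 4 * m := by
  have hτ2 : τ ^ 2 = 1 := by ext x; simp [pow_two, hτ x]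
  set B := univ.filter (fun x => τ x ≠ x ∧ g x = -1) with hB
  have hBdvd : 2 ∣ B.card := by
    apply dvd_card_of_free τ (by norm_num) hτ2 _ _ le_rfl
    · intro y hy
      simp only [hB, Finset.mem_filter, Finset.mem_univ, true_and] at hy ⊢
      refine ⟨by rw [hτ y]; exact Ne.symm hy.1, by rw [hinv y hy.1]; exact hy.2⟩
    · intro y hy k hk0 hk2
      simp only [hB, Finset.mem_filter, Finset.mem_univ, true_and] at hy
      have : k = 1 := by omega
      subst this
      simpa using hy.1
  obtain ⟨m, hm⟩ := hBdvd
  refine ⟨m, ?_⟩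
  have hsplit := card_filter_split (fun x => τ x ≠ x) (fun x => g x = -1) (ι := ι)
  -- the sum splits the same way
  rw [← Finset.sum_filter_add_sum_filter_not (univ.filter fun x => τ x ≠ x) (fun x => g x = -1), Finset.filter_filter,
    Finset.filter_filter]
  have sB : ∑ x ∈ univ.filter (fun x => τ x ≠ x ∧ g x = -1), g x = -(B.card : ℤ) := by
    rw [show ∑ x ∈ univ.filter (fun x => τ x ≠ x ∧ g x = -1), g x = ∑ x ∈ B, (-1 : ℤ) from
      Finset.sum_congr rfl fun x hx => by
        simp only [hB, Finset.mem_filter, Finset.mem_univ, true_and] at hx; exact hx.2]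
    simp
  have sA : ∑ x ∈ univ.filter (fun x => τ x ≠ x ∧ ¬ g x = -1), g x
      = ((univ.filter fun x => τ x ≠ x ∧ ¬ g x = -1).card : ℤ) := by
    rw [show ∑ x ∈ univ.filter (fun x => τ x ≠ x ∧ ¬ g x = -1), g x
        = ∑ x ∈ univ.filter (fun x => τ x ≠ x ∧ ¬ g x = -1), (1 : ℤ) from
      Finset.sum_congr rfl fun x hx => by
        simp only [Finset.mem_filter, Finset.mem_univ, true_and] at hx
        rcases hg x hx.1 with h | h
        · exact h
        · exact absurd h hx.2]
    simp
  rw [sB, sA, hsplit]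
  push_cast
  rw [hm]
  push_cast
  ring

end movedSums

section rowTrivial
variable {H : Matrix ι ι ℤ} {κ : Equiv.Perm ι} {d e : ι → ℤ}

/-- if the row permutation of a signed automorphism of a Hadamard matrix is trivial, the column permutation is an involution -/
theorem signedAut_snd_involutive_of_fst_eq_one (hH : IsHadamardMatrix H) (hcard : (Fintype.card ι : ℤ) ≠ 0)
    (haut : IsSignedAut H 1 κ d e) (j : ι) : κ (κ j) = j := by
  obtain ⟨hd, he, hA⟩ := haut
  by_contra hne
  have col : ∀ i, H i (κ (κ j)) = e (κ j) * e j * H i j := by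
    intro i
    have h1 := hA i (κ j)
    have h2 := hA i j
    simp only [Equiv.Perm.coe_one, id_eq] at h1 h2
    rw [h1, h2]
    have := pm_mul_self (hd i)
    calc d i * e (κ j) * (d i * e j * H i j) = (d i * d i) * (e (κ j) * e j * H i j) := by ring
      _ = e (κ j) * e j * H i j := by rw [this, one_mul]
  have orth := hadamard_col_orth H hH hcard hne
  have hval : ∑ i, H i (κ (κ j)) * H i j = e (κ j) * e j * Fintype.card ι := by
    rw [show ∑ i, H i (κ (κ j)) * H i j = ∑ i, e (κ j) * e j * (H i j * H i j) from
      Finset.sum_congr rfl fun i _ => by rw [col i]; ring, ← Finset.mul_sum, hadamard_col_self hH hcard j]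
  rw [hval] at orth
  exact (mul_ne_zero (mul_ne_zero (pm_ne_zero (he (κ j))) (pm_ne_zero (he j))) hcard) orth

/-- **Trivial row permutation forces trivial column permutation** when `|ι| ≡ 4 (mod 8)` and `|ι| ≠ 4`.  (If `κ ≠ 1`: the row
signs sum to `0` by column orthogonality, so no column is fixed and `|ι|/2 ≥ 3` rows carry `d = +1`; three of them are
pairwise orthogonal `±1` vectors, and the set where they agree is a union of free `κ`-orbits, so `8 ∣ |ι|`.)  `H(4)` with
`κ = (12)(34)`, `d = (+,−,+,−)` shows that `|ι| ≠ 4` is needed. -/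
theorem signedAut_snd_eq_one_of_fst_eq_one (hH : IsHadamardMatrix H) (hmod : Fintype.card ι % 8 = 4)
    (hne4 : Fintype.card ι ≠ 4) (haut : IsSignedAut H 1 κ d e) : κ = 1 := by
  have hcard : (Fintype.card ι : ℤ) ≠ 0 := by
    have : Fintype.card ι ≠ 0 := by omega
    exact_mod_cast this
  have hκκ := signedAut_snd_involutive_of_fst_eq_one hH hcard haut
  obtain ⟨hd, he, hA⟩ := haut
  simp only [Equiv.Perm.coe_one, id_eq] at hA
  by_contra hκ1
  obtain ⟨j₀, hj₀⟩ : ∃ j, κ j ≠ j := by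
    by_contra h
    exact hκ1 (Equiv.ext fun j => not_not.mp (not_exists.mp h j))
  -- (a) the row signs sum to zero
  have hsum : ∑ i, d i = 0 := by
    have orth := hadamard_col_orth H hH hcard (Ne.symm hj₀)
    rw [show ∑ i, H i j₀ * H i (κ j₀) = ∑ i, e j₀ * d i from Finset.sum_congr rfl fun i _ => by
      rw [hA i j₀]
      have := pm_mul_self (hH.1 i j₀)
      calc H i j₀ * (d i * e j₀ * H i j₀) = e j₀ * d i * (H i j₀ * H i j₀) := by ring
        _ = e j₀ * d i := by rw [this, mul_one], ← Finset.mul_sum] at orth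
    rcases mul_eq_zero.mp orth with h0 | h0
    · exact absurd h0 (pm_ne_zero (he j₀))
    · exact h0
  -- (b) no column is fixed
  have hfree : ∀ c, κ c ≠ c := by
    intro c hc
    have hdc : ∀ i, d i = e c := fun i =>
      signedAut_fixed_sign hH.1 (⟨hd, he, fun i j => by simpa using hA i j⟩ : IsSignedAut H 1 κ d e) (by simp) hc
    rw [Finset.sum_congr rfl fun i _ => hdc i, Finset.sum_const, Finset.card_univ, nsmul_eq_mul] at hsum
    exact (mul_ne_zero hcard (pm_ne_zero (he c))) hsum
  -- (c) column signs are κ-invariant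
  have heκ : ∀ j, e (κ j) = e j := by
    intro j
    obtain ⟨i⟩ : Nonempty ι := by
      by_contra h
      rw [not_nonempty_iff] at h
      have : Fintype.card ι = 0 := Fintype.card_eq_zero
      omega
    have h := signedAut_sq_sign hH.1 (⟨hd, he, fun i j => by simpa using hA i j⟩ : IsSignedAut H 1 κ d e)
      (fun _ => by simp) hκκ i j
    simp only [Equiv.Perm.coe_one, id_eq, pm_mul_self (hd i), one_mul] at h
    exact (pm_eq_of_mul_eq_one (he j) (he (κ j)) h).symm
  -- (d) the rows with d = +1: half of all rows, at least three
  set D := univ.filter (fun i => d i = 1) with hD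
  have hDcard : 2 * D.card = Fintype.card ι := by
    have hsplit := Finset.card_filter_add_card_filter_not (s := (univ : Finset ι)) (fun i => d i = 1)
    rw [Finset.card_univ] at hsplit
    have hs : ∑ i, d i = (D.card : ℤ) - ((univ.filter fun i => ¬ d i = 1).card : ℤ) := by
      rw [← Finset.sum_filter_add_sum_filter_not univ (fun i => d i = 1)]
      rw [show ∑ i ∈ univ.filter (fun i => d i = 1), d i = ∑ i ∈ univ.filter (fun i => d i = 1), (1 : ℤ) from
        Finset.sum_congr rfl fun i hi => (Finset.mem_filter.mp hi).2]
      rw [show ∑ i ∈ univ.filter (fun i => ¬ d i = 1), d i = ∑ i ∈ univ.filter (fun i => ¬ d i = 1), (-1 : ℤ) from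
        Finset.sum_congr rfl fun i hi => by
          have h := (Finset.mem_filter.mp hi).2
          rcases hd i with h' | h'
          · exact absurd h' h
          · exact h']
      rw [Finset.sum_const, Finset.sum_const]
      simp only [nsmul_eq_mul]
      ring
    rw [hsum] at hs
    have : (D.card : ℤ) = ((univ.filter fun i => ¬ d i = 1).card : ℤ) := by linarith
    have h' : D.card = (univ.filter fun i => ¬ d i = 1).card := by exact_mod_cast this
    rw [hD] at h' ⊢
    omega
  have h3 : 2 < D.card := by omega
  obtain ⟨i₁, i₂, i₃, hi₁, hi₂, hi₃, h12, h13, h23⟩ := Finset.two_lt_card_iff.mp h3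
  simp only [hD, Finset.mem_filter, Finset.mem_univ, true_and] at hi₁ hi₂ hi₃
  -- (e) three orthogonal rows
  have key := card_eq_four_mul_of_three_orth (univ : Finset ι) (fun j => H i₁ j) (fun j => H i₂ j) (fun j => H i₃ j)
    (fun j _ => hH.1 i₁ j) (fun j _ => hH.1 i₂ j) (fun j _ => hH.1 i₃ j)
    (hadamard_row_orth H hH h12) (hadamard_row_orth H hH h13) (hadamard_row_orth H hH h23)
  rw [Finset.card_univ] at key
  -- (f) the agreement set is a union of free κ-orbits
  set A := univ.filter (fun j => H i₁ j = H i₂ j ∧ H i₁ j = H i₃ j) with hAdef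
  have hrow1 : ∀ {i}, d i = 1 → ∀ j, H i (κ j) = e j * H i j := by
    intro i hi j; rw [hA i j, hi, one_mul]
  have hκ2 : κ ^ 2 = 1 := by ext x; simp [pow_two, hκκ x]
  have hAdvd : 2 ∣ A.card := by
    apply dvd_card_of_free κ (by norm_num) hκ2 _ _ le_rfl
    · intro y hy
      simp only [hAdef, Finset.mem_filter, Finset.mem_univ, true_and] at hy ⊢
      rw [hrow1 hi₁, hrow1 hi₂, hrow1 hi₃]
      exact ⟨by rw [hy.1], by rw [hy.2]⟩
    · intro y _ k hk0 hk2
      have : k = 1 := by omega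
      subst this
      simpa using hfree y
  obtain ⟨m, hm⟩ := hAdvd
  rw [hm] at key
  push_cast at key
  omega

/-- row version: a trivial COLUMN permutation forces a trivial row permutation (`|ι| ≡ 4 (mod 8)`, `|ι| ≠ 4`) -/
theorem signedAut_fst_eq_one_of_snd_eq_one {π : Equiv.Perm ι} (hH : IsHadamardMatrix H) (hmod : Fintype.card ι % 8 = 4)
    (hne4 : Fintype.card ι ≠ 4) (haut : IsSignedAut H π 1 d e) : π = 1 := by
  have hcard : (Fintype.card ι : ℤ) ≠ 0 := by
    have : Fintype.card ι ≠ 0 := by omega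
    exact_mod_cast this
  exact signedAut_snd_eq_one_of_fst_eq_one (isHadamard_transpose hH hcard) hmod hne4 (isSignedAut_transpose haut)

end rowTrivial

end Summit.Ventures.DiscreteObjects.Hadamard
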